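import Summits.QuantumFields.BalabanUV.Beta.GAN24.SymBorderGaugeLegContact
import Summits.QuantumFields.BalabanUV.Beta.GAN24.HessianGaugeLegContact

/-!
# `GAN24.SymHessianGaugeLegContact` — the FLUCTUATION-slot pure-gauge laws of an1's (0.4)-SYMMETRISED constraint-Hessian table `symHessFFAt ρ` (the type of
# the record field `SymTables.H` of the literal `JsB12Sym0`) and of its Λ-PIECE `SLam N c (symHessFFAt ρ L)` (any coefficient family `c`): kernel level
# (K-H)sym, PACKED and PAIRED — `([x′ = x] + [x′ + e_{α′} = x] − [r_b = x] − [r_b + L·e_μ = x]) · q¹,ρ_sym(α′, x′) ∕ 2`, NO Maxwell operator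

HONEST FRAMING (cell charter, verbatim): «discharging `BetaPertH` makes Bałaban's UV stability UNCONDITIONAL — a real constructive-QFT result;
it is NOT the continuum limit and NOT the Clay problem.»  DERIVED cell leaf (pub-balaban, G-an2-4 formalisation swarm → CRUX TEAM (2), seat
`b2b-balaban-gan24-formalise-leaf-02`, gen 47), the (0.4)-twin of `GAN24.HessianGaugeLegContact` asked by the row owner ([GAN24P1-G19-W1] (W3)).  [folklore]
kinematics: an1-g42's FUNCTIONAL Ward identity `SymAveragingWardRooted.symSkewHessAt_grad_left` read at indicator forms and on the packed block; the generic
lemmas of the comb files (`tsum_mul_ite4_mul`, `exists_finset_near`, `tsum_mul_neg_sum_tsum_eq`, `tsum_sum_dz_mul_eq`) BY NAME — nothing restated, no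
estimate, no limit, nothing cited, no `[cite:]` tag, no `def`, no `def … : Prop`; it instantiates NO binder of the β-function wall and discharges NO letter
of (CONV-C) or of row D1's END.  NEVER «G-an2-4 closed»; NOT hS0, NOT D1, NOT `BetaPertH`, NOT continuum, NOT Clay.  «not in print; our bookkeeping».
HONEST DEPENDENCY (cell records, verbatim): «continuum YM on T⁴ ⇐ BetaPertH ∧ nine spine estimates (0/9 proved); BetaPertH ⇐ (D1) ∧ (D4) ∧ CAP+tail;
G-an2-4 gates asym, D1 and NE2/3/4.»
ABSOLUTE RULE (cell charter, verbatim): «No internally-minted statement may enter as a cited fact. Every hypothesis is either kernel-proved in this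
package or a verbatim quotation of a PUBLISHED theorem with page reference. The manuscript(s) under audit are NOT citable for their own disputed steps —
they are the thing under adjudication; programme-internal (2001/route/tribunal) claims are never citable.»

THE OBJECTS (generic `d`, `ℤ^(d+1)`, `L ≥ 1`, root offset `ρ`, `e_κ := AffineAveraging.unitVec κ`, `r_b := L·y + ρ` the root of the coarse bond `b = (μ, y)`).
an1's (0.4)-symmetrised counts `symLinCountAt` ∕ `symHessCountAt` (`SymAveragingHessianCounts`), kernels `q¹,ρ_sym = symLinKerAt = LIN∕(d!·L^d)`,
`h^ρ_sym = symHessKerAt = HESS∕(2(d!)²L^d)`, the packed table `H_b := symHessFFAt ρ L μ y` (field–field block, ANTISYMMETRIC `symHessFFAt_antisymm`), and the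
Λ-piece `InterLevelTransport.SLam N c (fun μ y => symHessFFAt ρ L μ y)` — for the literal's record `H = symHessFFAt ρ_c Lc` and its multiplier tables
`M j = c j • symHessFFAt` (`SymTablesAn1FirstOrder`).
## What is proved ([folklore])
* §0 KERNEL LEVEL (NOT previously in the tree): **`symHessCountAt_div_left`** `Σ_κ (HESS_sym((κ, z − e_κ), f′) − HESS_sym((κ, z), f′)) = d! · ([f′₋ = z] + [f′₊ = z] −
  [r = z] − [r + L·e_μ = z]) · LIN_sym(f′)`, `symHessCountAt_div_right`, and the real form **`symHessKerAt_div_left`** `… = (indicator) · q¹,ρ_sym(f′) ∕ 2`.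
* §1 `H` PACKED: **`gaugeLeg_symHessFFAt_inl_inl`** (first slot), `_right` (second slot, sign −), **`gaugeLeg_symHessFFAt_tsum`** (every ψ, every root), the
  `dψ`-forms for a box root **`tsum_dz_mul_symHessFFAt`** ∕ **`tsum_symHessFFAt_mul_dz`**.
* §2 THE Λ-PIECE at the symmetrised Hessian (box root; ANY `c`): entry formula, vanishing blocks, ANTISYMMETRY, **`gaugeLeg_SLam_symHessFFAt_inl_inl`**,
  **`gaugeLeg_SLam_symHessFFAt_tsum`**, **`tsum_dz_mul_SLam_symHessFFAt`**, `tsum_SLam_symHessFFAt_mul_dz` — shapes VERBATIM those of the comb file with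
  `hessFFAt ↦ symHessFFAt`, `linKerAt ↦ symLinKerAt`.
NOT HERE: any contact CELL or power count (owner's X-gan24p1-g19-2 ∕ CT-3m); nothing about the multiplier coefficients' values.
Provenance: seat b2b-balaban-gan24-formalise-leaf-02 gen 47 (prover-…-leaf-02-g47-0), 2026-08-21; over an1's gen 41∕42 sym files and the comb files BY NAME.
-/

open Finset
open scoped BigOperators Nat
open Literature.MathematicalPhysics.QuantumFieldTheory.Balaban1983to89
open Literature.MathematicalPhysics.QuantumFieldTheory.Balaban1983to89.Beta
open AffineAveraging AveragingContours TransportedContourVariables AveragingHessianKernels AveragingWardJets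
  AveragingContoursRooted AveragingHessianKernelsRooted
open ExpKernelCalculus (MKer)
open OneStepResolventKernel (Fib)
open InterLevelTransport (SLam cwsum cwsum_apply)
open Summit.QuantumFields.BalabanUV.Beta.SymAveragingHessianCounts
open Summit.QuantumFields.BalabanUV.Beta.SymAveragingWardRooted
open Summit.QuantumFields.BalabanUV.Beta.LinearGaugeVH (nearBox mem_nearBox summable_of_finsupp)
open Summit.QuantumFields.BalabanUV.Beta.GAN24.BorderGaugeLegContact (tsum_sum_dz_mul_eq)
open Summit.QuantumFields.BalabanUV.Beta.GAN24.HessianGaugeLegContact (tsum_mul_ite4_mul exists_finset_near tsum_mul_neg_sum_tsum_eq)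

noncomputable section

namespace Summit.QuantumFields.BalabanUV.Beta.GAN24.SymHessianGaugeLegContact

variable {d : ℕ}

/-! ## §0 (K-H)sym — kernel level -/

section Kernel

/-- [folklore] **(K-H)sym BACKWARD-DIVERGENCE LAW OF THE SYMMETRISED W-HESSIAN COUNT in its first bond**:
`Σ_κ (symHessCountAt ρ (κ, z − e_κ) f′ − symHessCountAt ρ (κ, z) f′) = d! · ([f′₋ = z] + [f′₊ = z] − [r = z] − [r + L·e_μ = z]) · symLinCountAt ρ f′`, `r = L·y + ρ`
— an1-g42's functional identity `symSkewHessAt_grad_left` at indicator forms (node 8's script; the (0.4)-twin of node 8ρ's `hessCountAt_div_left`). -/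
theorem symHessCountAt_div_left (ρ : Fin d → ℤ) (L : ℕ) (μ : Fin d) (y : Fin d → ℤ) (z : Fin d → ℤ) (f' : Bond d) :
    ∑ κ : Fin d, (symHessCountAt ρ L μ y (κ, z - unitVec κ) f' - symHessCountAt ρ L μ y (κ, z) f')
      = (d ! : ℤ) * (((if f'.2 = z then 1 else 0) + (if f'.2 + unitVec f'.1 = z then 1 else 0)
          - (if (L : ℤ) • y + ρ = z then 1 else 0) - (if (L : ℤ) • y + ρ + (L : ℤ) • unitVec μ = z then 1 else 0))
        * symLinCountAt ρ L μ y f') := by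
  simp only [symHessCountAt_eq_symSkewHessAt, ← symSkewHessAt_sub_left, ← symSkewHessAt_sum_left, ← grad_siteδ, symSkewHessAt_grad_left,
    midF_mulZ_siteδ, symZ_single, symZ_δ1, siteδ_apply, AddMonoidHom.mul_apply, smul_eq_mul]
  ring

/-- [folklore] **(K-H′)sym … in its second bond** (antisymmetry `symHessCountAt_swap`). -/
theorem symHessCountAt_div_right (ρ : Fin d → ℤ) (L : ℕ) (μ : Fin d) (y : Fin d → ℤ) (f : Bond d) (z : Fin d → ℤ) :
    ∑ κ : Fin d, (symHessCountAt ρ L μ y f (κ, z - unitVec κ) - symHessCountAt ρ L μ y f (κ, z))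
      = -((d ! : ℤ) * (((if f.2 = z then 1 else 0) + (if f.2 + unitVec f.1 = z then 1 else 0)
          - (if (L : ℤ) • y + ρ = z then 1 else 0) - (if (L : ℤ) • y + ρ + (L : ℤ) • unitVec μ = z then 1 else 0))
        * symLinCountAt ρ L μ y f)) := by
  rw [← symHessCountAt_div_left, ← Finset.sum_neg_distrib]
  refine Finset.sum_congr rfl fun κ _ => ?_
  rw [symHessCountAt_swap ρ L μ y f (κ, z - unitVec κ), symHessCountAt_swap ρ L μ y f (κ, z)]
  ring

/-- [folklore] **(K-H)sym for the REAL symmetrised kernel** `h^ρ_sym = HESS∕(2(d!)²L^d)`: divergence `= (contact indicator) · q¹,ρ_sym(f′) ∕ 2`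
(`q¹,ρ_sym = LIN∕(d!·L^d)`; the same shape as the comb law `hessKerAt_div_left`). -/
theorem symHessKerAt_div_left {L : ℕ} (hL : 1 ≤ L) (ρ : Fin d → ℤ) (μ : Fin d) (y : Fin d → ℤ) (z : Fin d → ℤ) (f' : Bond d) :
    ∑ κ : Fin d, (symHessKerAt ρ L μ y (κ, z - unitVec κ) f' - symHessKerAt ρ L μ y (κ, z) f')
      = ((if f'.2 = z then 1 else 0) + (if f'.2 + unitVec f'.1 = z then 1 else 0)
          - (if (L : ℤ) • y + ρ = z then 1 else 0) - (if (L : ℤ) • y + ρ + (L : ℤ) • unitVec μ = z then 1 else 0))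
        * symLinKerAt ρ L μ y f' / 2 := by
  have hL' : (L : ℝ) ≠ 0 := by exact_mod_cast (show L ≠ 0 by omega)
  have hd : (d ! : ℝ) ≠ 0 := by exact_mod_cast (Nat.factorial_ne_zero d)
  simp only [symHessKerAt, symLinKerAt, ← sub_div, ← Finset.sum_div, ← Int.cast_sub, ← Int.cast_sum, symHessCountAt_div_left]
  push_cast
  field_simp

end Kernel

/-! ## §1 The constraint-Hessian table `symHessFFAt ρ L μ y` -/

section Hessian

/-- [folklore] **THE FLUCTUATION-SLOT PURE-GAUGE LAW OF THE (0.4)-SYMMETRISED CONSTRAINT HESSIAN, FIRST SLOT**: for the coarse bond `b = (μ, y)` with root `r_b = L·y + ρ`,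
`Σ_α (H_b (x − e_α) x′ (inl α) (inl α′) − H_b x x′ (inl α) (inl α′)) = ([x′ = x] + [x′ + e_{α′} = x] − [r_b = x] − [r_b + L·e_μ = x]) · q¹,ρ_b(α′, x′) ∕ 2`
— §0's (K-H)sym `symHessKerAt_div_left` read on the packed block. -/
theorem gaugeLeg_symHessFFAt_inl_inl {L : ℕ} (hL : 1 ≤ L) (ρ : Fin (d + 1) → ℤ) (μ : Fin (d + 1)) (y x x' : Fin (d + 1) → ℤ) (α' : Fin (d + 1)) :
    (∑ α, (symHessFFAt ρ L μ y (x - unitVec α) x' (Sum.inl α) (Sum.inl α') - symHessFFAt ρ L μ y x x' (Sum.inl α) (Sum.inl α')))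
      = ((if x' = x then 1 else 0) + (if x' + unitVec α' = x then 1 else 0)
          - (if (L : ℤ) • y + ρ = x then 1 else 0) - (if (L : ℤ) • y + ρ + (L : ℤ) • unitVec μ = x then 1 else 0))
        * symLinKerAt ρ L μ y (α', x') / 2 := by
  simp only [symHessFFAt_inl_inl]
  exact symHessKerAt_div_left hL ρ μ y x (α', x')

/-- [folklore] **… SECOND SLOT** (antisymmetry `symHessFFAt_antisymm`; opposite sign, roles of the two fluctuation bonds exchanged). -/
theorem gaugeLeg_symHessFFAt_inl_inl_right {L : ℕ} (hL : 1 ≤ L) (ρ : Fin (d + 1) → ℤ) (μ : Fin (d + 1)) (y x x' : Fin (d + 1) → ℤ) (α : Fin (d + 1)) :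
    (∑ α', (symHessFFAt ρ L μ y x (x' - unitVec α') (Sum.inl α) (Sum.inl α') - symHessFFAt ρ L μ y x x' (Sum.inl α) (Sum.inl α')))
      = -(((if x = x' then 1 else 0) + (if x + unitVec α = x' then 1 else 0)
          - (if (L : ℤ) • y + ρ = x' then 1 else 0) - (if (L : ℤ) • y + ρ + (L : ℤ) • unitVec μ = x' then 1 else 0))
        * symLinKerAt ρ L μ y (α, x) / 2) := by
  rw [← gaugeLeg_symHessFFAt_inl_inl hL ρ μ y x' x α, ← Finset.sum_neg_distrib]
  refine Finset.sum_congr rfl fun α' _ => ?_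
  rw [symHessFFAt_antisymm ρ L μ y (x' - unitVec α') x (Sum.inl α') (Sum.inl α), symHessFFAt_antisymm ρ L μ y x' x (Sum.inl α') (Sum.inl α)]
  ring

/-- [folklore] **THE FIRST-SLOT LAW PAIRED WITH ANY GAUGE FUNCTION** (every root):
`Σ'_x ψ x · Σ_α (H_b (x − e_α) x′ (inl α) (inl α′) − H_b x x′ (inl α) (inl α′)) = (ψ x′ + ψ(x′ + e_{α′}) − ψ(r_b) − ψ(r_b + L·e_μ)) · q¹,ρ_b(α′, x′) ∕ 2`. -/
theorem gaugeLeg_symHessFFAt_tsum {L : ℕ} (hL : 1 ≤ L) (ρ : Fin (d + 1) → ℤ) (μ : Fin (d + 1)) (y x' : Fin (d + 1) → ℤ) (α' : Fin (d + 1))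
    (ψ : (Fin (d + 1) → ℤ) → ℝ) :
    ∑' x, ψ x * ∑ α, (symHessFFAt ρ L μ y (x - unitVec α) x' (Sum.inl α) (Sum.inl α') - symHessFFAt ρ L μ y x x' (Sum.inl α) (Sum.inl α'))
      = (ψ x' + ψ (x' + unitVec α') - ψ ((L : ℤ) • y + ρ) - ψ ((L : ℤ) • y + ρ + (L : ℤ) • unitVec μ)) * symLinKerAt ρ L μ y (α', x') / 2 := by
  simp only [gaugeLeg_symHessFFAt_inl_inl hL, mul_div_assoc]
  rw [tsum_mul_ite4_mul]

/-- [folklore] For a box root the table vanishes unless its FIRST fluctuation site lies in the support box of `b` (`symHessKerAt_eq_zero_left`). -/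
theorem symHessFFAt_inl_inl_eq_zero_of_not_mem {L : ℕ} {r : Fin (d + 1) → ℕ} (hr : r ∈ box (d + 1) L) (μ : Fin (d + 1)) (y x' : Fin (d + 1) → ℤ)
    (α α' : Fin (d + 1)) {x : Fin (d + 1) → ℤ} (hx : x ∉ nearBox L y) :
    symHessFFAt (toSite r) L μ y x x' (Sum.inl α) (Sum.inl α') = 0 := by
  rw [mem_nearBox] at hx
  rw [symHessFFAt_inl_inl]
  exact symHessKerAt_eq_zero_left hr (f := (α, x)) hx _

/-- [folklore] … unless its SECOND fluctuation site lies in the support box (`symHessKerAt_eq_zero_right`). -/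
theorem symHessFFAt_inl_inl_eq_zero_of_not_mem_right {L : ℕ} {r : Fin (d + 1) → ℕ} (hr : r ∈ box (d + 1) L) (μ : Fin (d + 1)) (y x : Fin (d + 1) → ℤ)
    (α α' : Fin (d + 1)) {x' : Fin (d + 1) → ℤ} (hx' : x' ∉ nearBox L y) :
    symHessFFAt (toSite r) L μ y x x' (Sum.inl α) (Sum.inl α') = 0 := by
  rw [mem_nearBox] at hx'
  rw [symHessFFAt_inl_inl]
  exact symHessKerAt_eq_zero_right hr _ (f' := (α', x')) hx'

/-- [folklore] Any function times the table entry is summable over the first fluctuation site (finite support, box root). -/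
theorem summable_mul_symHessFFAt {L : ℕ} {r : Fin (d + 1) → ℕ} (hr : r ∈ box (d + 1) L) (μ : Fin (d + 1)) (y x' : Fin (d + 1) → ℤ)
    (α α' : Fin (d + 1)) (g : (Fin (d + 1) → ℤ) → ℝ) :
    Summable fun x => g x * symHessFFAt (toSite r) L μ y x x' (Sum.inl α) (Sum.inl α') :=
  summable_of_finsupp (nearBox L y) fun x hx => by rw [symHessFFAt_inl_inl_eq_zero_of_not_mem hr μ y x' α α' hx, mul_zero]

/-- [folklore] **THE `dψ`-FORM, FIRST SLOT** (box root `ρ = toSite r`, `r ∈ box`):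
`Σ'_x Σ_α (dz ψ) α x · H_b x x′ (inl α) (inl α′) = (ψ x′ + ψ(x′ + e_{α′}) − ψ(r_b) − ψ(r_b + L·e_μ)) · q¹,ρ_b(α′, x′) ∕ 2`, for EVERY `ψ`. -/
theorem tsum_dz_mul_symHessFFAt {L : ℕ} (hL : 1 ≤ L) {r : Fin (d + 1) → ℕ} (hr : r ∈ box (d + 1) L) (μ : Fin (d + 1)) (y x' : Fin (d + 1) → ℤ)
    (α' : Fin (d + 1)) (ψ : (Fin (d + 1) → ℤ) → ℝ) :
    ∑' x, ∑ α, dz ψ α x * symHessFFAt (toSite r) L μ y x x' (Sum.inl α) (Sum.inl α')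
      = (ψ x' + ψ (x' + unitVec α') - ψ ((L : ℤ) • y + toSite r) - ψ ((L : ℤ) • y + toSite r + (L : ℤ) • unitVec μ))
        * symLinKerAt (toSite r) L μ y (α', x') / 2 := by
  rw [tsum_sum_dz_mul_eq (fun α x => symHessFFAt (toSite r) L μ y x x' (Sum.inl α) (Sum.inl α'))
    (fun α g => summable_mul_symHessFFAt hr μ y x' α α' g) ψ]
  exact gaugeLeg_symHessFFAt_tsum hL (toSite r) μ y x' α' ψ

/-- [folklore] **THE `dψ`-FORM, SECOND SLOT**: `Σ'_{x′} Σ_{α′} H_b x x′ (inl α) (inl α′) · (dz ψ) α′ x′ = −(ψ x + ψ(x + e_α) − ψ(r_b) − ψ(r_b + L·e_μ)) · q¹,ρ_b(α, x) ∕ 2`. -/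
theorem tsum_symHessFFAt_mul_dz {L : ℕ} (hL : 1 ≤ L) {r : Fin (d + 1) → ℕ} (hr : r ∈ box (d + 1) L) (μ : Fin (d + 1)) (y x : Fin (d + 1) → ℤ)
    (α : Fin (d + 1)) (ψ : (Fin (d + 1) → ℤ) → ℝ) :
    ∑' x', ∑ α', symHessFFAt (toSite r) L μ y x x' (Sum.inl α) (Sum.inl α') * dz ψ α' x'
      = -((ψ x + ψ (x + unitVec α) - ψ ((L : ℤ) • y + toSite r) - ψ ((L : ℤ) • y + toSite r + (L : ℤ) • unitVec μ))
        * symLinKerAt (toSite r) L μ y (α, x) / 2) := by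
  have h : ∀ x', ∑ α', symHessFFAt (toSite r) L μ y x x' (Sum.inl α) (Sum.inl α') * dz ψ α' x'
      = -(∑ α', dz ψ α' x' * symHessFFAt (toSite r) L μ y x' x (Sum.inl α') (Sum.inl α)) := by
    intro x'
    rw [← Finset.sum_neg_distrib]
    refine Finset.sum_congr rfl fun α' _ => ?_
    rw [symHessFFAt_antisymm (toSite r) L μ y x' x (Sum.inl α') (Sum.inl α)]
    ring
  rw [tsum_congr h, tsum_neg, tsum_dz_mul_symHessFFAt hL hr μ y x α ψ]

end Hessian

/-! ## §2 The Λ-piece `SLam N c (symHessFFAt ρ L)` -/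

section Lambda

variable {N : ℕ} [NeZero N]

/-- [folklore] THE ENTRY FORMULA of the Λ-piece at the rooted Hessian tables, field–field block:
`SLam N c (symHessFFAt ρ L) κ′ u x x′ (inl α) (inl α′) = −Σ_μ Σ'_y c μ y κ′ u · h^ρ_{(μ,y)}((α, x), (α′, x′))`. -/
theorem SLam_symHessFFAt_inl_inl (ρ : Fin (d + 1) → ℤ) (L : ℕ) (c : Fin (d + 1) → (Fin (d + 1) → ℤ) → Fin (d + 1) → (Fin (d + 1) → ℤ) → ℝ)
    (κ' : Fin (d + 1)) (u x x' : Fin (d + 1) → ℤ) (α α' : Fin (d + 1)) :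
    SLam N c (fun μ y => symHessFFAt ρ L μ y) κ' u x x' (Sum.inl α) (Sum.inl α')
      = -∑ μ, ∑' y, c μ y κ' u * symHessKerAt ρ L μ y (α, x) (α', x') := by
  simp only [SLam, cwsum_apply, symHessFFAt_inl_inl]

/-- [folklore] The Λ-piece vanishes on the `(inl, inr)` block (so does `symHessFFAt`). -/
theorem SLam_symHessFFAt_inl_inr (ρ : Fin (d + 1) → ℤ) (L : ℕ) (c : Fin (d + 1) → (Fin (d + 1) → ℤ) → Fin (d + 1) → (Fin (d + 1) → ℤ) → ℝ)
    (κ' : Fin (d + 1)) (u x x' : Fin (d + 1) → ℤ) (α μ' : Fin (d + 1)) :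
    SLam N c (fun μ y => symHessFFAt ρ L μ y) κ' u x x' (Sum.inl α) (Sum.inr μ') = 0 := by
  simp [SLam, cwsum_apply]

/-- [folklore] The Λ-piece vanishes on the multiplier rows (so does `symHessFFAt`). -/
theorem SLam_symHessFFAt_inr (ρ : Fin (d + 1) → ℤ) (L : ℕ) (c : Fin (d + 1) → (Fin (d + 1) → ℤ) → Fin (d + 1) → (Fin (d + 1) → ℤ) → ℝ)
    (κ' : Fin (d + 1)) (u x x' : Fin (d + 1) → ℤ) (μ' : Fin (d + 1)) (b : Fib d) :
    SLam N c (fun μ y => symHessFFAt ρ L μ y) κ' u x x' (Sum.inr μ') b = 0 := by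
  simp [SLam, cwsum_apply]

/-- [folklore] **THE Λ-PIECE IS ANTISYMMETRIC** under the exchange of its two kernel slots (it inherits `symHessFFAt_antisymm` termwise). -/
theorem SLam_symHessFFAt_antisymm (ρ : Fin (d + 1) → ℤ) (L : ℕ) (c : Fin (d + 1) → (Fin (d + 1) → ℤ) → Fin (d + 1) → (Fin (d + 1) → ℤ) → ℝ)
    (κ' : Fin (d + 1)) (u x x' : Fin (d + 1) → ℤ) (a b : Fib d) :
    SLam N c (fun μ y => symHessFFAt ρ L μ y) κ' u x' x b a = -SLam N c (fun μ y => symHessFFAt ρ L μ y) κ' u x x' a b := by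
  simp only [SLam, cwsum_apply, neg_neg]
  rw [← Finset.sum_neg_distrib]
  refine Finset.sum_congr rfl fun μ _ => ?_
  rw [← tsum_neg]
  refine tsum_congr fun y => ?_
  rw [symHessFFAt_antisymm ρ L μ y x x' a b]
  ring

/-- [folklore] For a box root, the coarse sum of the Λ-piece entry is FINITE: it runs over the coarse bonds whose support box contains the second fluctuation site. -/
theorem tsum_coeff_mul_symHessKerAt_eq_sum {L : ℕ} {r : Fin (d + 1) → ℕ} (hr : r ∈ box (d + 1) L) {s : Finset (Fin (d + 1) → ℤ)} {x' : Fin (d + 1) → ℤ}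
    (hs : ∀ y, Near L y x' → y ∈ s) (w : (Fin (d + 1) → ℤ) → ℝ) (μ : Fin (d + 1)) (f : Bond (d + 1)) (α' : Fin (d + 1)) :
    ∑' y, w y * symHessKerAt (toSite r) L μ y f (α', x') = ∑ y ∈ s, w y * symHessKerAt (toSite r) L μ y f (α', x') :=
  tsum_eq_sum fun y hy => by rw [symHessKerAt_eq_zero_right hr f (f' := (α', x')) (fun h => hy (hs y h)), mul_zero]

/-- [folklore] **THE FLUCTUATION-SLOT PURE-GAUGE LAW OF THE Λ-PIECE, FIRST SLOT, ENTRYWISE** (box root `ρ = toSite r`, `r ∈ box`; ANY coefficient family `c`):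
`Σ_α (SΛ κ′ u (x − e_α) x′ (inl α) (inl α′) − SΛ κ′ u x x′ (inl α) (inl α′))
  = −Σ_μ Σ'_y c μ y κ′ u · ([x′ = x] + [x′ + e_{α′} = x] − [L·y + ρ = x] − [L·y + ρ + L·e_μ = x]) · q¹,ρ_{(μ,y)}(α′, x′) ∕ 2`. -/
theorem gaugeLeg_SLam_symHessFFAt_inl_inl {L : ℕ} (hL : 1 ≤ L) {r : Fin (d + 1) → ℕ} (hr : r ∈ box (d + 1) L)
    (c : Fin (d + 1) → (Fin (d + 1) → ℤ) → Fin (d + 1) → (Fin (d + 1) → ℤ) → ℝ) (κ' : Fin (d + 1)) (u x x' : Fin (d + 1) → ℤ) (α' : Fin (d + 1)) :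
    (∑ α, (SLam N c (fun μ y => symHessFFAt (toSite r) L μ y) κ' u (x - unitVec α) x' (Sum.inl α) (Sum.inl α')
        - SLam N c (fun μ y => symHessFFAt (toSite r) L μ y) κ' u x x' (Sum.inl α) (Sum.inl α')))
      = -∑ μ, ∑' y, c μ y κ' u *
          ((((if x' = x then 1 else 0) + (if x' + unitVec α' = x then 1 else 0)
              - (if (L : ℤ) • y + toSite r = x then 1 else 0) - (if (L : ℤ) • y + toSite r + (L : ℤ) • unitVec μ = x then 1 else 0))
            * symLinKerAt (toSite r) L μ y (α', x') / 2)) := by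
  obtain ⟨s, hs⟩ := exists_finset_near hL x'
  have hR : ∀ μ, ∑' y, c μ y κ' u *
      ((((if x' = x then 1 else 0) + (if x' + unitVec α' = x then 1 else 0)
          - (if (L : ℤ) • y + toSite r = x then 1 else 0) - (if (L : ℤ) • y + toSite r + (L : ℤ) • unitVec μ = x then 1 else 0))
        * symLinKerAt (toSite r) L μ y (α', x') / 2))
      = ∑ y ∈ s, c μ y κ' u *
      ((((if x' = x then 1 else 0) + (if x' + unitVec α' = x then 1 else 0)
          - (if (L : ℤ) • y + toSite r = x then 1 else 0) - (if (L : ℤ) • y + toSite r + (L : ℤ) • unitVec μ = x then 1 else 0))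
        * symLinKerAt (toSite r) L μ y (α', x') / 2)) := by
    intro μ
    exact tsum_eq_sum fun y hy => by rw [symLinKerAt_eq_zero hr (f := (α', x')) (fun h => hy (hs y h))]; ring
  simp only [SLam_symHessFFAt_inl_inl, tsum_coeff_mul_symHessKerAt_eq_sum hr hs, hR]
  -- finite bookkeeping: `Σ_α (−A(α) − (−B(α))) = −Σ_μ Σ_{y∈s} c · Σ_α (h(x − e_α) − h(x))`
  have e1 : ∀ α, -(∑ μ, ∑ y ∈ s, c μ y κ' u * symHessKerAt (toSite r) L μ y (α, x - unitVec α) (α', x'))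
        - -(∑ μ, ∑ y ∈ s, c μ y κ' u * symHessKerAt (toSite r) L μ y (α, x) (α', x'))
      = -(∑ μ, ∑ y ∈ s, c μ y κ' u * (symHessKerAt (toSite r) L μ y (α, x - unitVec α) (α', x') - symHessKerAt (toSite r) L μ y (α, x) (α', x'))) := by
    intro α
    simp only [mul_sub, Finset.sum_sub_distrib]
    ring
  rw [Finset.sum_congr rfl fun α _ => e1 α, Finset.sum_neg_distrib, Finset.sum_comm]
  congr 1
  refine Finset.sum_congr rfl fun μ _ => ?_
  rw [Finset.sum_comm]
  refine Finset.sum_congr rfl fun y _ => ?_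
  rw [← Finset.mul_sum, symHessKerAt_div_left hL (toSite r) μ y x (α', x')]

/-- [folklore] For a box root the Λ-piece entry vanishes unless its first fluctuation site lies in the (finite) union of the support boxes of the coarse bonds near
the second site. -/
theorem SLam_symHessFFAt_inl_inl_eq_zero_of_not_mem {L : ℕ} {r : Fin (d + 1) → ℕ} (hr : r ∈ box (d + 1) L) {s : Finset (Fin (d + 1) → ℤ)}
    {x' : Fin (d + 1) → ℤ} (hs : ∀ y, Near L y x' → y ∈ s) (c : Fin (d + 1) → (Fin (d + 1) → ℤ) → Fin (d + 1) → (Fin (d + 1) → ℤ) → ℝ)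
    (κ' : Fin (d + 1)) (u : Fin (d + 1) → ℤ) (α α' : Fin (d + 1)) {x : Fin (d + 1) → ℤ} (hx : x ∉ s.biUnion fun y => nearBox L y) :
    SLam N c (fun μ y => symHessFFAt (toSite r) L μ y) κ' u x x' (Sum.inl α) (Sum.inl α') = 0 := by
  rw [SLam_symHessFFAt_inl_inl, neg_eq_zero]
  refine Finset.sum_eq_zero fun μ _ => ?_
  rw [tsum_coeff_mul_symHessKerAt_eq_sum hr hs]
  refine Finset.sum_eq_zero fun y hy => ?_
  have hxy : x ∉ nearBox L y := fun h => hx (Finset.mem_biUnion.2 ⟨y, hy, h⟩)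
  rw [mem_nearBox] at hxy
  rw [symHessKerAt_eq_zero_left hr (f := (α, x)) hxy _, mul_zero]

/-- [folklore] Any function times the Λ-piece entry is summable over the first fluctuation site (finite support, box root). -/
theorem summable_mul_SLam_symHessFFAt {L : ℕ} (hL : 1 ≤ L) {r : Fin (d + 1) → ℕ} (hr : r ∈ box (d + 1) L)
    (c : Fin (d + 1) → (Fin (d + 1) → ℤ) → Fin (d + 1) → (Fin (d + 1) → ℤ) → ℝ) (κ' : Fin (d + 1)) (u x' : Fin (d + 1) → ℤ) (α α' : Fin (d + 1))
    (g : (Fin (d + 1) → ℤ) → ℝ) :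
    Summable fun x => g x * SLam N c (fun μ y => symHessFFAt (toSite r) L μ y) κ' u x x' (Sum.inl α) (Sum.inl α') := by
  obtain ⟨s, hs⟩ := exists_finset_near hL x'
  exact summable_of_finsupp (s.biUnion fun y => nearBox L y) fun x hx => by
    rw [SLam_symHessFFAt_inl_inl_eq_zero_of_not_mem hr hs c κ' u α α' hx, mul_zero]

/-- [folklore] **THE FLUCTUATION-SLOT LAW OF THE Λ-PIECE PAIRED WITH ANY GAUGE FUNCTION** (box root):
`Σ'_x ψ x · Σ_α (SΛ κ′ u (x − e_α) x′ … − SΛ κ′ u x x′ …) = −Σ_μ Σ'_y c μ y κ′ u · (ψ x′ + ψ(x′ + e_{α′}) − ψ(L·y + ρ) − ψ(L·y + ρ + L·e_μ)) · q¹,ρ_{(μ,y)}(α′, x′) ∕ 2`. -/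
theorem gaugeLeg_SLam_symHessFFAt_tsum {L : ℕ} (hL : 1 ≤ L) {r : Fin (d + 1) → ℕ} (hr : r ∈ box (d + 1) L)
    (c : Fin (d + 1) → (Fin (d + 1) → ℤ) → Fin (d + 1) → (Fin (d + 1) → ℤ) → ℝ) (κ' : Fin (d + 1)) (u x' : Fin (d + 1) → ℤ) (α' : Fin (d + 1))
    (ψ : (Fin (d + 1) → ℤ) → ℝ) :
    ∑' x, ψ x * ∑ α, (SLam N c (fun μ y => symHessFFAt (toSite r) L μ y) κ' u (x - unitVec α) x' (Sum.inl α) (Sum.inl α')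
        - SLam N c (fun μ y => symHessFFAt (toSite r) L μ y) κ' u x x' (Sum.inl α) (Sum.inl α'))
      = -∑ μ, ∑' y, c μ y κ' u *
          ((ψ x' + ψ (x' + unitVec α') - ψ ((L : ℤ) • y + toSite r) - ψ ((L : ℤ) • y + toSite r + (L : ℤ) • unitVec μ))
            * symLinKerAt (toSite r) L μ y (α', x') / 2) := by
  obtain ⟨s, hs⟩ := exists_finset_near hL x'
  simp only [gaugeLeg_SLam_symHessFFAt_inl_inl hL hr]
  refine (tsum_mul_neg_sum_tsum_eq (s := s) ψ _ (fun μ y x hy => ?_) (fun μ y => ?_)).trans ?_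
  · rw [symLinKerAt_eq_zero hr (f := (α', x')) (fun h => hy (hs y h))]
    ring
  · refine summable_of_finsupp
      ({x', x' + unitVec α', (L : ℤ) • y + toSite r, (L : ℤ) • y + toSite r + (L : ℤ) • unitVec μ} : Finset (Fin (d + 1) → ℤ))
      fun x hx => ?_
    have h1 : x' ≠ x := fun h => hx (by rw [← h]; simp)
    have h2 : x' + unitVec α' ≠ x := fun h => hx (by rw [← h]; simp)
    have h3 : (L : ℤ) • y + toSite r ≠ x := fun h => hx (by rw [← h]; simp)
    have h4 : (L : ℤ) • y + toSite r + (L : ℤ) • unitVec μ ≠ x := fun h => hx (by rw [← h]; simp)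
    rw [if_neg h1, if_neg h2, if_neg h3, if_neg h4]
    ring
  · congr 1
    refine Finset.sum_congr rfl fun μ _ => tsum_congr fun y => ?_
    rw [tsum_congr (fun x => mul_left_comm (ψ x) _ _), tsum_mul_left]
    simp only [mul_div_assoc]
    rw [tsum_mul_ite4_mul]

/-- [folklore] **THE `dψ`-FORM OF THE Λ-PIECE LAW, FIRST SLOT** (box root; EVERY `ψ`, EVERY coefficient family `c` — so in particular Bałaban's
`c = lamCoeffK (KInvStep Lc (j+1)) (E2 d Lc (j+1)) Lc` at every level):
`Σ'_x Σ_α (dz ψ) α x · SΛ κ′ u x x′ (inl α) (inl α′) = −Σ_μ Σ'_y c μ y κ′ u · (ψ x′ + ψ(x′ + e_{α′}) − ψ(L·y + ρ) − ψ(L·y + ρ + L·e_μ)) · q¹,ρ_{(μ,y)}(α′, x′) ∕ 2`. -/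
theorem tsum_dz_mul_SLam_symHessFFAt {L : ℕ} (hL : 1 ≤ L) {r : Fin (d + 1) → ℕ} (hr : r ∈ box (d + 1) L)
    (c : Fin (d + 1) → (Fin (d + 1) → ℤ) → Fin (d + 1) → (Fin (d + 1) → ℤ) → ℝ) (κ' : Fin (d + 1)) (u x' : Fin (d + 1) → ℤ) (α' : Fin (d + 1))
    (ψ : (Fin (d + 1) → ℤ) → ℝ) :
    ∑' x, ∑ α, dz ψ α x * SLam N c (fun μ y => symHessFFAt (toSite r) L μ y) κ' u x x' (Sum.inl α) (Sum.inl α')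
      = -∑ μ, ∑' y, c μ y κ' u *
          ((ψ x' + ψ (x' + unitVec α') - ψ ((L : ℤ) • y + toSite r) - ψ ((L : ℤ) • y + toSite r + (L : ℤ) • unitVec μ))
            * symLinKerAt (toSite r) L μ y (α', x') / 2) := by
  rw [tsum_sum_dz_mul_eq (fun α x => SLam N c (fun μ y => symHessFFAt (toSite r) L μ y) κ' u x x' (Sum.inl α) (Sum.inl α'))
    (fun α g => summable_mul_SLam_symHessFFAt hL hr c κ' u x' α α' g) ψ]
  exact gaugeLeg_SLam_symHessFFAt_tsum hL hr c κ' u x' α' ψ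

/-- [folklore] **THE `dψ`-FORM, SECOND SLOT** (antisymmetry): `Σ'_{x′} Σ_{α′} SΛ κ′ u x x′ (inl α) (inl α′) · (dz ψ) α′ x′
  = Σ_μ Σ'_y c μ y κ′ u · (ψ x + ψ(x + e_α) − ψ(L·y + ρ) − ψ(L·y + ρ + L·e_μ)) · q¹,ρ_{(μ,y)}(α, x) ∕ 2`. -/
theorem tsum_SLam_symHessFFAt_mul_dz {L : ℕ} (hL : 1 ≤ L) {r : Fin (d + 1) → ℕ} (hr : r ∈ box (d + 1) L)
    (c : Fin (d + 1) → (Fin (d + 1) → ℤ) → Fin (d + 1) → (Fin (d + 1) → ℤ) → ℝ) (κ' : Fin (d + 1)) (u x : Fin (d + 1) → ℤ) (α : Fin (d + 1))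
    (ψ : (Fin (d + 1) → ℤ) → ℝ) :
    ∑' x', ∑ α', SLam N c (fun μ y => symHessFFAt (toSite r) L μ y) κ' u x x' (Sum.inl α) (Sum.inl α') * dz ψ α' x'
      = ∑ μ, ∑' y, c μ y κ' u *
          ((ψ x + ψ (x + unitVec α) - ψ ((L : ℤ) • y + toSite r) - ψ ((L : ℤ) • y + toSite r + (L : ℤ) • unitVec μ))
            * symLinKerAt (toSite r) L μ y (α, x) / 2) := by
  have h : ∀ x', ∑ α', SLam N c (fun μ y => symHessFFAt (toSite r) L μ y) κ' u x x' (Sum.inl α) (Sum.inl α') * dz ψ α' x'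
      = -(∑ α', dz ψ α' x' * SLam N c (fun μ y => symHessFFAt (toSite r) L μ y) κ' u x' x (Sum.inl α') (Sum.inl α)) := by
    intro x'
    rw [← Finset.sum_neg_distrib]
    refine Finset.sum_congr rfl fun α' _ => ?_
    rw [SLam_symHessFFAt_antisymm (toSite r) L c κ' u x' x (Sum.inl α') (Sum.inl α)]
    ring
  rw [tsum_congr h, tsum_neg, tsum_dz_mul_SLam_symHessFFAt hL hr c κ' u x α ψ, neg_neg]

end Lambda

end Summit.QuantumFields.BalabanUV.Beta.GAN24.SymHessianGaugeLegContact

end
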